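import Mathlib.Analysis.Matrix.Order

/-!
# Two Rayleigh-quotient inequalities for positive semidefinite complex matrices
(helper for crux stmt-QuantumFields-9737 `QuarksAsStableAction.StableActionBridge`, line `Sketch`;
registered stubs `re_dotProduct_mulVec_mulVec_le_of_posSemidef` and `re_dotProduct_mulVec_le_sum_norm`
of lead c5, cycle 6)

Pointwise in the background gauge field `U`, the fermionic transfer operator `T = T̂_F(U)` of lattice
QCD with Wilson quarks is a Hermitian positive (semi)definite complex matrix on the Fock space of the
slice quark modes, and the bound `R(Ψ) ≤ Λ` on the Rayleigh quotient
`R(Ψ) = Re⟨T̂_FΨ, T̂_U T̂_FΨ⟩ / Re⟨Ψ, T̂_FΨ⟩` of the lead's assembly reduces to two pieces of finite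
dimensional linear algebra, proved here with the inner-product convention `⟨u, w⟩ = star u ⬝ᵥ w`,
`‖v‖₂² = Re (star v ⬝ᵥ v) = Σ_i ‖v_i‖²`:

* `re_dotProduct_mulVec_mulVec_le_of_posSemidef` — if `0 ≤ T` and `Re⟨v, Tv⟩ ≤ Λ ‖v‖₂²` for all `v`
  (i.e. `T ≤ Λ` as forms), then `⟨Tv, Tv⟩ ≤ Λ Re⟨v, Tv⟩` for all `v` (i.e. `T² ≤ ΛT`).  Proof: with
  the positive square root `R = √T` of the C⋆-order on matrices (`CFC.sqrt`, `Rᴴ = R`, `R R = T`) and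
  `w = Rv` one has `Tv = Rw`, `⟨Rw, Rw⟩ = ⟨w, Tw⟩` and `⟨v, Tv⟩ = ⟨Rv, Rv⟩ = ⟨w, w⟩`, so the claim
  is the hypothesis at `w`. [folklore]
* `re_dotProduct_mulVec_le_sum_norm` — the crude form bound `Re⟨v, Tv⟩ ≤ (Σ_{ij} ‖T_ij‖) ‖v‖₂²` for an
  arbitrary square complex matrix, from `|v̄_i T_ij v_j| ≤ ‖T_ij‖ (‖v_i‖² + ‖v_j‖²)/2`. [folklore]

Pure theorem file (no definitions); Mathlib only.
-/

noncomputable section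

namespace Summit.QuantumFields.QCD.Cruxes.StableActionBridge.Sketch

open scoped ComplexOrder MatrixOrder
open Matrix

namespace PosSemidefRayleigh

/-- Adjointness of a Hermitian matrix for the pairing `⟨u, w⟩ = star u ⬝ᵥ w`, combined with
`R R = T`: `⟨Rx, Ry⟩ = ⟨x, Ty⟩`. [folklore] -/
theorem star_mulVec_dotProduct_mulVec_of_isHermitian {n : Type*} [Fintype n]
    {R T : Matrix n n ℂ} (hR : Rᴴ = R) (hRR : R * R = T) (x y : n → ℂ) :
    star (R *ᵥ x) ⬝ᵥ (R *ᵥ y) = star x ⬝ᵥ (T *ᵥ y) := by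
  rw [star_mulVec, hR, ← dotProduct_mulVec, mulVec_mulVec, hRR]

/-- `Re (star v ⬝ᵥ v) = Σ_k ‖v_k‖²`. [folklore] -/
theorem re_star_dotProduct_self {n : Type*} [Fintype n] (v : n → ℂ) :
    (star v ⬝ᵥ v).re = ∑ k, ‖v k‖ ^ 2 := by
  simp only [dotProduct, Pi.star_apply, Complex.star_def, Complex.conj_mul', Complex.re_sum]
  refine Finset.sum_congr rfl fun k _ => ?_
  rw [← Complex.ofReal_pow, Complex.ofReal_re]

/-- `‖v_i‖ ‖v_j‖ ≤ Σ_k ‖v_k‖²` (from `2ab ≤ a² + b²`). [folklore] -/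
theorem norm_mul_norm_le_sum_sq {n : Type*} [Fintype n] (v : n → ℂ) (i j : n) :
    ‖v i‖ * ‖v j‖ ≤ ∑ k, ‖v k‖ ^ 2 := by
  have hk : ∀ k, ‖v k‖ ^ 2 ≤ ∑ k, ‖v k‖ ^ 2 := fun k =>
    Finset.single_le_sum (fun k _ => sq_nonneg ‖v k‖) (Finset.mem_univ k)
  nlinarith [two_mul_le_add_sq ‖v i‖ ‖v j‖, hk i, hk j]

end PosSemidefRayleigh

open PosSemidefRayleigh in
/-- **`T² ≤ ΛT` from `0 ≤ T ≤ Λ`** (registered sub-goal `re_dotProduct_mulVec_mulVec_le_of_posSemidef`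
of crux stmt-QuantumFields-9737, line `Sketch`).  For a positive semidefinite complex matrix `T` with
`Re⟨v, Tv⟩ ≤ Λ‖v‖₂²` for all `v`, one has `Re⟨Tv, Tv⟩ ≤ Λ Re⟨v, Tv⟩` for all `v`: with `R = √T`
(`CFC.sqrt`, Hermitian, `R R = T`) and `w = Rv`, `⟨Tv, Tv⟩ = ⟨Rw, Rw⟩ = ⟨w, Tw⟩ ≤ Λ⟨w, w⟩ = Λ⟨v, Tv⟩`.
[folklore] -/
theorem re_dotProduct_mulVec_mulVec_le_of_posSemidef : ∀ (n : Type) [Fintype n] [DecidableEq n] (T : Matrix n n ℂ) (Λ : ℝ), T.PosSemidef → (∀ v : n → ℂ, (star v ⬝ᵥ (T *ᵥ v)).re ≤ Λ * (star v ⬝ᵥ v).re) → ∀ v : n → ℂ, (star (T *ᵥ v) ⬝ᵥ (T *ᵥ v)).re ≤ Λ * (star v ⬝ᵥ (T *ᵥ v)).re := by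
  intro n _ _ T Λ hT hΛ v
  have hR : (CFC.sqrt T)ᴴ = CFC.sqrt T := (CFC.sqrt_nonneg T).posSemidef.isHermitian
  have hRR : CFC.sqrt T * CFC.sqrt T = T := CFC.sqrt_mul_sqrt_self T hT.nonneg
  have hTv : T *ᵥ v = CFC.sqrt T *ᵥ (CFC.sqrt T *ᵥ v) := by rw [mulVec_mulVec, hRR]
  rw [hTv, star_mulVec_dotProduct_mulVec_of_isHermitian hR hRR, ← hTv,
    ← star_mulVec_dotProduct_mulVec_of_isHermitian hR hRR v v]
  exact hΛ (CFC.sqrt T *ᵥ v)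

open PosSemidefRayleigh in
/-- **Crude form bound `Re⟨v, Tv⟩ ≤ (Σ_{ij} ‖T_ij‖) ‖v‖₂²`** (registered sub-goal
`re_dotProduct_mulVec_le_sum_norm` of crux stmt-QuantumFields-9737, line `Sketch`), for every square
complex matrix `T` and vector `v`: expand `⟨v, Tv⟩ = Σ_{ij} v̄_i T_ij v_j` and use
`Re z ≤ ‖z‖`, `‖v̄_i T_ij v_j‖ = ‖T_ij‖ ‖v_i‖ ‖v_j‖ ≤ ‖T_ij‖ Σ_k ‖v_k‖²`. [folklore] -/
theorem re_dotProduct_mulVec_le_sum_norm : ∀ (n : Type) [Fintype n] (T : Matrix n n ℂ) (v : n → ℂ), (star v ⬝ᵥ (T *ᵥ v)).re ≤ (∑ i, ∑ j, ‖T i j‖) * (star v ⬝ᵥ v).re := by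
  intro n _ T v
  have hexp : star v ⬝ᵥ (T *ᵥ v) = ∑ i, ∑ j, star (v i) * (T i j * v j) := by
    simp only [dotProduct, mulVec, Pi.star_apply, Finset.mul_sum]
  rw [hexp, re_star_dotProduct_self, Complex.re_sum, Finset.sum_mul]
  refine Finset.sum_le_sum fun i _ => ?_
  rw [Complex.re_sum, Finset.sum_mul]
  refine Finset.sum_le_sum fun j _ => ?_
  calc (star (v i) * (T i j * v j)).re ≤ ‖star (v i) * (T i j * v j)‖ := Complex.re_le_norm _
    _ = ‖T i j‖ * (‖v i‖ * ‖v j‖) := by rw [norm_mul, norm_mul, norm_star]; ring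
    _ ≤ ‖T i j‖ * ∑ k, ‖v k‖ ^ 2 :=
        mul_le_mul_of_nonneg_left (norm_mul_norm_le_sum_sq v i j) (norm_nonneg _)

end Summit.QuantumFields.QCD.Cruxes.StableActionBridge.Sketch

end
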